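import Literature.Computability.Cryptography.ChenQuantumLWECheckBoxMarginals
import Mathlib.RingTheory.Ideal.Quotient.Basic
import Mathlib.RingTheory.Ideal.Maximal
import Mathlib.Data.Nat.PrimeFin
import Mathlib.Data.Nat.Factorization.Basic
import Mathlib.Data.Nat.Log
import Mathlib.Algebra.Order.BigOperators.Ring.Finset

/-!
# Digit observers of the Step-9 register, IV: the exceptional rows have density `≤ Σ_{p ∣ q} p^{−ℓ}` (T24)

REPRODUCTION / ANALYSIS OF A CLAIMED RESULT UNDER ADJUDICATION (withdrawn): Yilei Chen, *Quantum
Algorithms for Lattice Problems*, IACR ePrint 2024/555, version of 2024-04-18 [ChenQuantumLattice2024]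
(the version carrying the author's note that Step 9 contains a bug), the LWE instance as the `q`-ary
lattice `L_q^⊥(A)`, `A = [2p₁t | Uᵀ | I_m] ∈ ℤ_q^{m×n}` with `U ∈ ℤ_q^{ℓ×m}` UNIFORM (§3.2 pp. 16–18,
head of §3.3 p. 18; Lemma 3.2's factorisation of a composite `q`, p. 17), eq. (12) p. 17, Step 9
(§3.5.9, pp. 34–38).  Bundle `papers/QuantumAdvantage/lwe-quantum-autopsy/`, Part 2 (`REPAIR-CENSUS.md`
§32, theorem **T24**, census row G7), sequel of `ChenQuantumLWECheckBoxMarginals.lean` (T23), whose one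
surviving hypothesis on the public matrix — every row's free part GENERATES the unit ideal of `ℤ_q`
(`hrow`) — is here (A) characterised prime by prime, (B)–(C) shown to fail on a set of `U`-blocks of
counting density at most `m · Σ_{p ∣ q prime} p^{−ℓ}` (exactly `q^{−ℓ}` per row for prime `q`), and
(D) fed back into T23; (E) records the algebra of the regime in which the resulting cap is informative
(REFEREE R-63.4).  HONEST FRAMING: kernel-checked THEOREMS of elementary commutative algebra and
counting over `ℤ_q`, closing the last quantitative by-hand clause on the digit side of census row G7;
a statement about the statistics of a WITHDRAWN algorithm's register; NOT summit progress, no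
cryptanalytic claim in either direction, no new algorithm.

## What is proved

**A. The prime-divisor criterion** (`exists_primeFactor_dvd_of_not_gen`, `gen_iff_forall_primeFactors`).
A vector `u ∈ ℤ_q^α` generates the unit ideal (`∃ c, Σ_k c_k u_k = 1`) **iff** for every prime `p ∣ q`
some entry is not a multiple of `p` (as a residue in `[0,q)`).  "Only if": reduce modulo `p`.  "If": a
proper ideal of the finite ring `ℤ_q` lies in a maximal ideal, whose residue field has prime
characteristic `p ∣ q` and kills every `u_k`.

**B. Counting** (`card_filter_dvd_val`, `card_filter_forall_dvd_val`, `card_nonGen_le`,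
`density_nonGen_le`, `nonGen_eq_singleton_zero`).  For `p ∣ q` exactly `q/p` residues are multiples of
`p`, so exactly `(q/p)^ℓ` vectors of `ℤ_q^ℓ` have all entries divisible by `p`; by A the EXCEPTIONAL SET
`nonGen` of non-generating vectors is contained in the union of these over the prime factors of `q`, so
`#nonGen ≤ Σ_{p ∣ q} (q/p)^ℓ`, i.e. density `q^{−ℓ}·#nonGen ≤ Σ_{p ∣ q} p^{−ℓ} ≤ ω(q)·2^{−ℓ}`,
`ω(q) = #primeFactors(q) ≤ log₂ q` (`card_primeFactors_le_log`); for PRIME `q` the exceptional set is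
`{0}` exactly (density `q^{−ℓ}`, the bound attained).

**C. Rows** (`badBlocks`, `card_badBlocks_le`, `density_badBlocks_le`).  For an `m`-row block
`V ∈ (ℤ_q^ℓ)^m` (Chen's `Uᵀ`, row `j` = `U_{·j}`), the blocks with SOME non-generating row number at most
`m · #nonGen · (q^ℓ)^{m−1}`: density `≤ m · Σ_{p ∣ q} p^{−ℓ}` — the census's "all but a `≤ q^{−ℓ}`
fraction of instances per row", for every modulus.

**D. Back into T23** (`row_generates_of_block`, `chenSysCheckBoxDigitObserver_le_centred_of_block`).
If the entries of row `j` on ANY set of free columns (the secret block) generate `ℤ_q`, the row satisfies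
T23's `hrow` (pad the combination with zeros); hence T23's cap
`≤ 1/Q + Dp₁(Q²−1)‖b‖₁/(2Qq)` for every instance whose `U`-block lies OUTSIDE `badBlocks` — whatever the
head column `2p₁t` — i.e. for all instances but a counted exceptional set of density `≤ m·Σ_{p∣q}p^{−ℓ}`.

**E. The informative regime** (`cap_lt_one_iff`, `cap_regime_of_norm_bound`, `l1_le_sqrt_card_mul_l2`).
The cap is `< 1` iff `Dp₁(Q+1)‖b‖₁ < 2q` (for `Q > 1`); with `N = p₁Q` this follows from `DN‖b‖₁ < q`,
and `‖b‖₁ ≤ √(n+1)·‖b‖₂` (Cauchy–Schwarz); so a modulus bound `q ≥ K·D·N·‖b‖₂²` with `√(n+1) < K‖b‖₂`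
suffices — the shape of the census's by-hand regime line (§31.2: `K = 31D²log⁵n` from C.4/C.7,
`‖b‖₂ ≥ 0.8p₁√(ℓ(n−κ))` from Lemma 3.6 (3)); the two instance inequalities stay hypotheses here.

## What is NOT here

The probability space is the counting measure on `U`-blocks (uniform `U`, as in LWE); the head column
`2p₁t_j` (which could only help a row generate) is not used.  Lemma A of the census (§24.3: the hidden
vector's law is uniform on the parity-check box — a modelling statement about Steps 1–8) stays by hand;
so do Chen's conditions C.1–C.7 themselves (E takes their consequences as hypotheses).  Coherent
observers (row G7's residual) are untouched.  Nothing here bears on the hardness of LWE.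
-/

namespace Literature.Computability.Cryptography.Chen2024

open scoped BigOperators
open Finset

/-! ### A. Generating vectors of `ℤ_q`: the prime-divisor criterion -/

section Generates

variable (q : ℕ) [NeZero q] {α : Type*} [Fintype α]

/-- **Prime witness of non-generation.**  If no `ℤ_q`-combination of the entries of `u` equals `1`,
then for some prime `p ∣ q` every entry of `u` is a multiple of `p`.  (A proper ideal of the finite
ring `ℤ_q` lies in a maximal ideal; its residue field has prime characteristic dividing `q`.)
[folklore] -/
theorem exists_primeFactor_dvd_of_not_gen (u : α → ZMod q)
    (h : ¬ ∃ c : α → ZMod q, ∑ k, c k * u k = 1) :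
    ∃ p ∈ q.primeFactors, ∀ k, p ∣ (u k).val := by
  classical
  let I : Ideal (ZMod q) := Ideal.span (Set.range u)
  have hI : I ≠ ⊤ := by
    intro htop
    have h1 : (1 : ZMod q) ∈ I := by
      rw [htop]
      exact Submodule.mem_top
    obtain ⟨c, hc⟩ := Ideal.mem_span_range_iff_exists_fun.1 h1
    exact h ⟨c, hc⟩
  obtain ⟨M, hM, hIM⟩ := Ideal.exists_le_maximal I hI
  haveI : M.IsPrime := hM.isPrime
  obtain ⟨p, hp⟩ := CharP.exists (ZMod q ⧸ M)
  have hq0 : ((q : ℕ) : ZMod q ⧸ M) = 0 := by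
    rw [← map_natCast (Ideal.Quotient.mk M), ZMod.natCast_self, map_zero]
  have hpq : p ∣ q := (CharP.cast_eq_zero_iff (ZMod q ⧸ M) p q).1 hq0
  have hp' : p.Prime := by
    rcases CharP.char_is_prime_or_zero (ZMod q ⧸ M) p with hp' | hp0
    · exact hp'
    · exfalso
      rw [hp0, zero_dvd_iff] at hpq
      exact NeZero.ne q hpq
  refine ⟨p, Nat.mem_primeFactors.2 ⟨hp', hpq, NeZero.ne q⟩, fun k => ?_⟩
  have hk : Ideal.Quotient.mk M (u k) = 0 :=
    Ideal.Quotient.eq_zero_iff_mem.2 (hIM (Ideal.subset_span ⟨k, rfl⟩))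
  have hk' : (((u k).val : ℕ) : ZMod q ⧸ M) = 0 := by
    rw [← map_natCast (Ideal.Quotient.mk M), ZMod.natCast_zmod_val]
    exact hk
  exact (CharP.cast_eq_zero_iff (ZMod q ⧸ M) p _).1 hk'

/-- **Converse**: a generating vector has, for every prime `p ∣ q`, an entry that is not a multiple of
`p` (reduce the combination modulo `p`). [folklore] -/
theorem exists_not_dvd_of_gen (u : α → ZMod q) (hu : ∃ c : α → ZMod q, ∑ k, c k * u k = 1)
    {p : ℕ} (hp : p ∈ q.primeFactors) : ∃ k, ¬ p ∣ (u k).val := by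
  obtain ⟨c, hc⟩ := hu
  obtain ⟨hpp, hpq, -⟩ := Nat.mem_primeFactors.1 hp
  by_contra h
  have h' : ∀ k, p ∣ (u k).val := fun k => by
    by_contra hk
    exact h ⟨k, hk⟩
  haveI : Fact (1 < p) := ⟨hpp.one_lt⟩
  let φ : ZMod q →+* ZMod p := ZMod.castHom hpq (ZMod p)
  have hφ : ∀ k, φ (u k) = 0 := fun k => by
    rw [← ZMod.natCast_zmod_val (u k), map_natCast, ZMod.natCast_eq_zero_iff]
    exact h' k
  have h1 := congr_arg φ hc
  rw [map_sum, map_one] at h1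
  simp only [map_mul, hφ, mul_zero, Finset.sum_const_zero] at h1
  exact zero_ne_one h1

/-- **The prime-divisor criterion**: `u` generates the unit ideal of `ℤ_q` iff for every prime factor
`p` of `q` some entry of `u` is not divisible by `p`. [folklore] -/
theorem gen_iff_forall_primeFactors (u : α → ZMod q) :
    (∃ c : α → ZMod q, ∑ k, c k * u k = 1) ↔ ∀ p ∈ q.primeFactors, ∃ k, ¬ p ∣ (u k).val := by
  constructor
  · intro hu p hp
    exact exists_not_dvd_of_gen q u hu hp
  · intro h
    by_contra hu
    obtain ⟨p, hp, hpk⟩ := exists_primeFactor_dvd_of_not_gen q u hu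
    obtain ⟨k, hk⟩ := h p hp
    exact hk (hpk k)

end Generates

/-! ### B. Counting the exceptional set -/

section Counting

variable (q : ℕ) [NeZero q] {α : Type*} [Fintype α] [DecidableEq α]

/-- The EXCEPTIONAL SET: vectors of `ℤ_q^α` whose entries do NOT generate the unit ideal.
[cite: ChenQuantumLattice2024, §3.2 pp. 16–18 (uniform `U`); census §31.1, §32] -/
noncomputable def nonGen : Finset (α → ZMod q) :=
  univ.filter fun u => ¬ ∃ c : α → ZMod q, ∑ k, c k * u k = 1

/-- Membership in the exceptional set. [folklore] -/
theorem mem_nonGen {u : α → ZMod q} :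
    u ∈ nonGen q (α := α) ↔ ¬ ∃ c : α → ZMod q, ∑ k, c k * u k = 1 := by
  rw [nonGen, mem_filter]
  exact ⟨fun h => h.2, fun h => ⟨mem_univ _, h⟩⟩

/-- **Multiples of `p` in `ℤ_q`**: for `p ∣ q` exactly `q / p` residues have representative divisible by
`p`. [folklore] -/
theorem card_filter_dvd_val {p : ℕ} (hp : 0 < p) (hpq : p ∣ q) :
    (univ.filter fun x : ZMod q => p ∣ x.val).card = q / p := by
  obtain ⟨d, hd⟩ := hpq
  have hd' : q / p = d := by
    rw [hd, Nat.mul_div_cancel_left d hp]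
  rw [hd']
  have himage : (univ.filter fun x : ZMod q => p ∣ x.val)
      = (range d).image fun i => ((p * i : ℕ) : ZMod q) := by
    ext x
    simp only [mem_filter, mem_univ, true_and, mem_image, mem_range]
    constructor
    · rintro ⟨j, hj⟩
      refine ⟨j, ?_, ?_⟩
      · have hlt : x.val < q := ZMod.val_lt x
        rw [hj, hd] at hlt
        exact Nat.lt_of_mul_lt_mul_left hlt
      · rw [← hj, ZMod.natCast_zmod_val]
    · rintro ⟨i, hi, rfl⟩
      refine ⟨i, ?_⟩
      rw [ZMod.val_natCast, Nat.mod_eq_of_lt]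
      rw [hd]
      exact Nat.mul_lt_mul_of_pos_left hi hp
  rw [himage, card_image_of_injOn, card_range]
  intro i hi j hj hij
  have hi' : p * i < q := by
    rw [hd]
    exact Nat.mul_lt_mul_of_pos_left (mem_range.1 (mem_coe.1 hi)) hp
  have hj' : p * j < q := by
    rw [hd]
    exact Nat.mul_lt_mul_of_pos_left (mem_range.1 (mem_coe.1 hj)) hp
  have hv := congr_arg ZMod.val hij
  simp only [ZMod.val_natCast, Nat.mod_eq_of_lt hi', Nat.mod_eq_of_lt hj'] at hv
  exact Nat.eq_of_mul_eq_mul_left hp hv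

/-- **Vectors with all entries divisible by `p`**: exactly `(q/p)^{#α}` of them. [folklore] -/
theorem card_filter_forall_dvd_val {p : ℕ} (hp : 0 < p) (hpq : p ∣ q) :
    (univ.filter fun u : α → ZMod q => ∀ k, p ∣ (u k).val).card = (q / p) ^ Fintype.card α := by
  have h : (univ.filter fun u : α → ZMod q => ∀ k, p ∣ (u k).val)
      = Fintype.piFinset fun _ : α => univ.filter fun x : ZMod q => p ∣ x.val := by
    ext u
    simp only [mem_filter, mem_univ, true_and, Fintype.mem_piFinset]
  rw [h, Fintype.card_piFinset, prod_const, card_univ, card_filter_dvd_val q hp hpq]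

/-- **The exceptional set lies in the union of the prime-divisor events.** [folklore] -/
theorem nonGen_subset_biUnion :
    nonGen q (α := α)
      ⊆ q.primeFactors.biUnion fun p => univ.filter fun u : α → ZMod q => ∀ k, p ∣ (u k).val := by
  intro u hu
  obtain ⟨p, hp, hpk⟩ := exists_primeFactor_dvd_of_not_gen q u ((mem_nonGen q).1 hu)
  exact mem_biUnion.2 ⟨p, hp, mem_filter.2 ⟨mem_univ _, hpk⟩⟩

/-- **T24 (count)**: `#nonGen ≤ Σ_{p ∣ q prime} (q/p)^{#α}`. [folklore] -/
theorem card_nonGen_le :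
    (nonGen q (α := α)).card ≤ ∑ p ∈ q.primeFactors, (q / p) ^ Fintype.card α := by
  refine (card_le_card (nonGen_subset_biUnion q)).trans (card_biUnion_le.trans ?_)
  refine sum_le_sum fun p hp => ?_
  obtain ⟨hpp, hpq, -⟩ := Nat.mem_primeFactors.1 hp
  rw [card_filter_forall_dvd_val q hpp.pos hpq]

/-- **T24 (density)**: the exceptional set has counting density `≤ Σ_{p ∣ q prime} p^{−#α}` in `ℤ_q^α`.
[folklore] -/
theorem density_nonGen_le :
    ((q : ℝ) ^ Fintype.card α)⁻¹ * ((nonGen q (α := α)).card : ℝ)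
      ≤ ∑ p ∈ q.primeFactors, ((p : ℝ)⁻¹) ^ Fintype.card α := by
  have hq : (q : ℝ) ≠ 0 := Nat.cast_ne_zero.2 (NeZero.ne q)
  have hqℓ : ((q : ℝ) ^ Fintype.card α) ≠ 0 := pow_ne_zero _ hq
  have hcast : ((nonGen q (α := α)).card : ℝ)
      ≤ ∑ p ∈ q.primeFactors, ((q : ℝ) / p) ^ Fintype.card α := by
    have h := card_nonGen_le q (α := α)
    have h' : ((nonGen q (α := α)).card : ℝ)
        ≤ ((∑ p ∈ q.primeFactors, (q / p) ^ Fintype.card α : ℕ) : ℝ) := by exact_mod_cast h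
    refine h'.trans (le_of_eq ?_)
    rw [Nat.cast_sum]
    refine sum_congr rfl fun p hp => ?_
    obtain ⟨hpp, hpq, -⟩ := Nat.mem_primeFactors.1 hp
    rw [Nat.cast_pow, Nat.cast_div hpq (Nat.cast_ne_zero.2 hpp.ne_zero)]
  calc ((q : ℝ) ^ Fintype.card α)⁻¹ * ((nonGen q (α := α)).card : ℝ)
      ≤ ((q : ℝ) ^ Fintype.card α)⁻¹ * ∑ p ∈ q.primeFactors, ((q : ℝ) / p) ^ Fintype.card α :=
        mul_le_mul_of_nonneg_left hcast (inv_nonneg.2 (pow_nonneg (Nat.cast_nonneg _) _))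
    _ = ∑ p ∈ q.primeFactors, ((p : ℝ)⁻¹) ^ Fintype.card α := by
        rw [mul_sum]
        refine sum_congr rfl fun p _ => ?_
        rw [div_eq_mul_inv, mul_pow, inv_mul_cancel_left₀ hqℓ]

/-- `2^{ω(q)} ≤ q`: the prime factors of `q ≠ 0` are at least `2` each and their product divides `q`.
[folklore] -/
theorem two_pow_card_primeFactors_le : 2 ^ q.primeFactors.card ≤ q :=
  (pow_card_le_prod q.primeFactors (fun p => p) 2 fun _ hp =>
      (Nat.prime_of_mem_primeFactors hp).two_le).trans
    (Nat.le_of_dvd (Nat.pos_of_ne_zero (NeZero.ne q)) (Nat.prod_primeFactors_dvd q))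

/-- `ω(q) ≤ log₂ q`. [folklore] -/
theorem card_primeFactors_le_log : q.primeFactors.card ≤ Nat.log 2 q :=
  Nat.le_log_of_pow_le one_lt_two (two_pow_card_primeFactors_le q)

/-- **Crude form**: density of the exceptional set `≤ ω(q) · 2^{−#α} ≤ log₂ q · 2^{−#α}`. [folklore] -/
theorem density_nonGen_le_log :
    ((q : ℝ) ^ Fintype.card α)⁻¹ * ((nonGen q (α := α)).card : ℝ)
      ≤ (Nat.log 2 q : ℝ) * ((2 : ℝ)⁻¹) ^ Fintype.card α := by
  refine (density_nonGen_le q).trans ?_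
  have hterm : ∀ p ∈ q.primeFactors, ((p : ℝ)⁻¹) ^ Fintype.card α ≤ ((2 : ℝ)⁻¹) ^ Fintype.card α :=
    fun p hp => by
      have h2 : (2 : ℝ) ≤ p := by exact_mod_cast (Nat.prime_of_mem_primeFactors hp).two_le
      exact pow_le_pow_left₀ (inv_nonneg.2 (Nat.cast_nonneg _))
        (inv_anti₀ two_pos h2) _
  calc ∑ p ∈ q.primeFactors, ((p : ℝ)⁻¹) ^ Fintype.card α
      ≤ ∑ p ∈ q.primeFactors, ((2 : ℝ)⁻¹) ^ Fintype.card α := sum_le_sum hterm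
    _ = (q.primeFactors.card : ℝ) * ((2 : ℝ)⁻¹) ^ Fintype.card α := by
        rw [sum_const, nsmul_eq_mul]
    _ ≤ (Nat.log 2 q : ℝ) * ((2 : ℝ)⁻¹) ^ Fintype.card α :=
        mul_le_mul_of_nonneg_right (by exact_mod_cast card_primeFactors_le_log q)
          (pow_nonneg (inv_nonneg.2 zero_le_two) _)

/-- **Prime modulus: the exceptional set is `{0}` exactly** (so its density is `q^{−#α}` and the bound of
`density_nonGen_le` is attained). [folklore] -/
theorem nonGen_eq_singleton_zero [Fact q.Prime] : nonGen q (α := α) = {0} := by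
  ext u
  rw [mem_nonGen, mem_singleton]
  constructor
  · intro h
    by_contra hu
    obtain ⟨k, hk⟩ : ∃ k, u k ≠ 0 := by
      by_contra h'
      apply hu
      funext k
      by_contra hk
      exact h' ⟨k, hk⟩
    apply h
    refine ⟨Pi.single k (u k)⁻¹, ?_⟩
    rw [Finset.sum_eq_single_of_mem k (mem_univ k) fun k' _ hk' => by
      rw [Pi.single_eq_of_ne hk', zero_mul], Pi.single_eq_same, inv_mul_cancel₀ hk]
  · rintro rfl
    rintro ⟨c, hc⟩
    simp only [Pi.zero_apply, mul_zero, Finset.sum_const_zero] at hc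
    exact zero_ne_one hc

/-- For prime `q` the exceptional set has exactly one element. [folklore] -/
theorem card_nonGen_of_prime [Fact q.Prime] : (nonGen q (α := α)).card = 1 := by
  rw [nonGen_eq_singleton_zero q, card_singleton]

end Counting

/-! ### C. Blocks of rows: some row exceptional -/

section Rows

variable (q : ℕ) [NeZero q] {α : Type*} [Fintype α] [DecidableEq α]
  {ι : Type*} [Fintype ι] [DecidableEq ι]

/-- The EXCEPTIONAL BLOCKS: `m`-row blocks `V ∈ (ℤ_q^α)^ι` (Chen's `Uᵀ`, one row per sample) with SOME
row in the exceptional set. [cite: ChenQuantumLattice2024, §3.2 pp. 16–18; census §32] -/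
noncomputable def badBlocks : Finset (ι → α → ZMod q) :=
  univ.filter fun V => ∃ j, V j ∈ nonGen q (α := α)

/-- Membership in the exceptional blocks. [folklore] -/
theorem mem_badBlocks {V : ι → α → ZMod q} :
    V ∈ badBlocks q (α := α) (ι := ι) ↔ ∃ j, V j ∈ nonGen q (α := α) := by
  rw [badBlocks, mem_filter]
  exact ⟨fun h => h.2, fun h => ⟨mem_univ _, h⟩⟩

/-- Outside the exceptional blocks every row generates. [folklore] -/
theorem forall_gen_of_not_mem_badBlocks {V : ι → α → ZMod q}
    (hV : V ∉ badBlocks q (α := α) (ι := ι)) (j : ι) :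
    ∃ c : α → ZMod q, ∑ k, c k * V j k = 1 := by
  by_contra h
  exact hV ((mem_badBlocks q).2 ⟨j, (mem_nonGen q).2 h⟩)

/-- **One prescribed row in a prescribed set**: at most `#S · (q^{#α})^{#ι − 1}` blocks. [folklore] -/
theorem card_filter_row_mem_le (S : Finset (α → ZMod q)) (j : ι) :
    (univ.filter fun V : ι → α → ZMod q => V j ∈ S).card
      ≤ S.card * (q ^ Fintype.card α) ^ (Fintype.card ι - 1) := by
  let t : ι → Finset (α → ZMod q) := fun i => if i = j then S else univ
  have hsub : (univ.filter fun V : ι → α → ZMod q => V j ∈ S) ⊆ Fintype.piFinset t := by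
    intro V hV
    rw [Fintype.mem_piFinset]
    intro i
    by_cases hi : i = j
    · subst hi
      simp only [t, if_pos rfl]
      exact (mem_filter.1 hV).2
    · simp only [t, if_neg hi]
      exact mem_univ _
  refine (card_le_card hsub).trans (le_of_eq ?_)
  rw [Fintype.card_piFinset, Fintype.prod_eq_mul_prod_compl j]
  have hj : (t j).card = S.card := by simp only [t, if_pos rfl]
  have hrest : ∏ i ∈ ({j} : Finset ι)ᶜ, (t i).card
      = (q ^ Fintype.card α) ^ (Fintype.card ι - 1) := by
    rw [prod_congr rfl fun i hi => by
      rw [show t i = univ from if_neg (fun h => (mem_compl.1 hi) (mem_singleton.2 h)), card_univ,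
        Fintype.card_fun, ZMod.card]]
    rw [prod_const, card_compl, card_singleton]
  rw [hj, hrest]

/-- **T24 (rows, count)**: `#badBlocks ≤ #ι · #nonGen · (q^{#α})^{#ι − 1}`. [folklore] -/
theorem card_badBlocks_le :
    (badBlocks q (α := α) (ι := ι)).card
      ≤ Fintype.card ι * ((nonGen q (α := α)).card * (q ^ Fintype.card α) ^ (Fintype.card ι - 1)) := by
  have hsub : badBlocks q (α := α) (ι := ι)
      ⊆ (univ : Finset ι).biUnion fun j => univ.filter fun V : ι → α → ZMod q => V j ∈ nonGen q := by
    intro V hV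
    obtain ⟨j, hj⟩ := (mem_badBlocks q).1 hV
    exact mem_biUnion.2 ⟨j, mem_univ _, mem_filter.2 ⟨mem_univ _, hj⟩⟩
  refine (card_le_card hsub).trans (card_biUnion_le.trans ?_)
  calc ∑ j ∈ (univ : Finset ι), (univ.filter fun V : ι → α → ZMod q => V j ∈ nonGen q).card
      ≤ ∑ _j ∈ (univ : Finset ι),
          (nonGen q (α := α)).card * (q ^ Fintype.card α) ^ (Fintype.card ι - 1) :=
        sum_le_sum fun j _ => card_filter_row_mem_le q (nonGen q) j
    _ = Fintype.card ι * ((nonGen q (α := α)).card * (q ^ Fintype.card α) ^ (Fintype.card ι - 1)) := by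
        rw [sum_const, card_univ, smul_eq_mul]

/-- **T24 (rows, density)**: the exceptional blocks have counting density `≤ #ι · Σ_{p ∣ q prime} p^{−#α}`
in `(ℤ_q^α)^ι` — "every public row non-zero modulo every prime factor of `q`, for all instances but a
`≤ m·Σ_{p∣q} p^{−ℓ}` fraction" (`= m·q^{−ℓ}` for prime `q`; census §31.1 made kernel). [folklore] -/
theorem density_badBlocks_le :
    ((q : ℝ) ^ (Fintype.card α * Fintype.card ι))⁻¹ * ((badBlocks q (α := α) (ι := ι)).card : ℝ)
      ≤ (Fintype.card ι : ℝ) * ∑ p ∈ q.primeFactors, ((p : ℝ)⁻¹) ^ Fintype.card α := by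
  have hq : (q : ℝ) ≠ 0 := Nat.cast_ne_zero.2 (NeZero.ne q)
  set L : ℝ := (q : ℝ) ^ Fintype.card α with hL
  have hL0 : L ≠ 0 := pow_ne_zero _ hq
  rcases Nat.eq_zero_or_pos (Fintype.card ι) with h0 | hpos
  · -- no rows: the exceptional set of blocks is empty
    have hempty : badBlocks q (α := α) (ι := ι) = ∅ := by
      haveI : IsEmpty ι := Fintype.card_eq_zero_iff.1 h0
      ext V
      simp only [mem_badBlocks, IsEmpty.exists_iff, Finset.notMem_empty]
    rw [hempty, card_empty, Nat.cast_zero, mul_zero]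
    exact mul_nonneg (Nat.cast_nonneg _)
      (sum_nonneg fun p _ => pow_nonneg (inv_nonneg.2 (Nat.cast_nonneg _)) _)
  · have hcard : ((badBlocks q (α := α) (ι := ι)).card : ℝ)
        ≤ (Fintype.card ι : ℝ) * (((nonGen q (α := α)).card : ℝ) * L ^ (Fintype.card ι - 1)) := by
      have h := card_badBlocks_le q (α := α) (ι := ι)
      have h' : ((badBlocks q (α := α) (ι := ι)).card : ℝ)
          ≤ ((Fintype.card ι * ((nonGen q (α := α)).card
              * (q ^ Fintype.card α) ^ (Fintype.card ι - 1)) : ℕ) : ℝ) := by exact_mod_cast h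
      simpa [hL] using h'
    have hpow : (q : ℝ) ^ (Fintype.card α * Fintype.card ι) = L ^ (Fintype.card ι - 1) * L := by
      rw [hL, ← pow_succ, Nat.sub_add_cancel hpos, pow_mul]
    rw [hpow]
    calc (L ^ (Fintype.card ι - 1) * L)⁻¹ * ((badBlocks q (α := α) (ι := ι)).card : ℝ)
        ≤ (L ^ (Fintype.card ι - 1) * L)⁻¹
            * ((Fintype.card ι : ℝ) * (((nonGen q (α := α)).card : ℝ) * L ^ (Fintype.card ι - 1))) :=
          mul_le_mul_of_nonneg_left hcard (inv_nonneg.2 (mul_nonneg (pow_nonneg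
            (pow_nonneg (Nat.cast_nonneg _) _) _) (pow_nonneg (Nat.cast_nonneg _) _)))
      _ = (Fintype.card ι : ℝ) * (L⁻¹ * ((nonGen q (α := α)).card : ℝ)) := by
          field_simp
      _ ≤ (Fintype.card ι : ℝ) * ∑ p ∈ q.primeFactors, ((p : ℝ)⁻¹) ^ Fintype.card α :=
          mul_le_mul_of_nonneg_left (density_nonGen_le q (α := α)) (Nat.cast_nonneg _)

end Rows

/-! ### D. Back into T23: the cap outside the exceptional blocks -/

section Block

variable (q : ℕ) [NeZero q] {α : Type*} [Fintype α] [DecidableEq α]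

omit [NeZero q] [DecidableEq α] in
/-- **Padding with zeros**: if the entries of row `j` on a family `e` of FREE columns generate `ℤ_q`,
row `j` satisfies T23's `hrow`. (`e` need not be injective.) [folklore] -/
theorem row_generates_of_block {m : ℕ} {ι : Type*} [Fintype ι] (τ : ι → Fin m)
    (M : ι → Fin m → ZMod q) (j : ι) (e : α → Fin m) (he : ∀ a, e a ∈ freeCols τ)
    (hV : ∃ c : α → ZMod q, ∑ a, c a * M j (e a) = 1) :
    ∃ c : Fin m → ZMod q, ∑ k ∈ freeCols τ, c k * M j k = 1 := by
  obtain ⟨c, hc⟩ := hV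
  refine ⟨fun k => ∑ a ∈ univ.filter (fun a => e a = k), c a, ?_⟩
  calc ∑ k ∈ freeCols τ, (∑ a ∈ univ.filter (fun a => e a = k), c a) * M j k
      = ∑ k ∈ freeCols τ, ∑ a ∈ univ.filter (fun a => e a = k), c a * M j (e a) := by
        refine sum_congr rfl fun k _ => ?_
        rw [sum_mul]
        refine sum_congr rfl fun a ha => ?_
        rw [(mem_filter.1 ha).2]
    _ = ∑ a, c a * M j (e a) := sum_fiberwise_of_maps_to (fun a _ => he a) _
    _ = 1 := hc

variable (n : ℕ) (D p₁ Q : ℕ+) (b : Fin (n + 1) → ℤ)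

/-- **T24 (Chen form) — the box-wrap cap outside the exceptional blocks.**  T23's
`chenSysCheckBoxDigitObserver_le_centred` with its row hypothesis `hrow` replaced by: the entries of
every row on a family `e` of free columns (the secret block `U_{·j}` of row `j` of `[2p₁t | Uᵀ | I_m]`)
form a block OUTSIDE `badBlocks` — a set of counting density `≤ m·Σ_{p∣q prime} p^{−ℓ}`
(`density_badBlocks_le`), whatever the head column.  Conclusion verbatim: every digit observer of the
Step-9 register reads the datum with probability at most `1/Q + Dp₁(Q²−1)‖b‖₁/(2Qq)`.
[cite: ChenQuantumLattice2024, §3.5.9 pp. 35–37, §3.2 pp. 16–18, eq. (12) p. 17; census §26.2, §31, §32] -/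
theorem chenSysCheckBoxDigitObserver_le_centred_of_block (hP : Odd ((p₁ * Q : ℕ+) : ℕ))
    (hb : b 0 = -1) (hunit : IsUnit ((2 * D * D * p₁ : ℕ) : ZQ Q))
    {Sd ι : Type*} [Fintype Sd] [DecidableEq Sd] [Fintype ι] [DecidableEq ι]
    (τ : ι → Fin (n + 1)) (hτ : Function.Injective τ)
    (M : ι → Fin (n + 1) → ZMod q) (e : α → Fin (n + 1)) (he : ∀ a, e a ∈ freeCols τ)
    (hV : (fun j a => M j (e a)) ∉ badBlocks q (α := α) (ι := ι))
    (hbκ : ∀ j, sysCheck q τ M j b = 0)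
    (w₀ : Fin (n + 1) → ℤ) (f : (Fin (n + 1) → ℤ) → Sd)
    (hf : ∀ k, ∀ ν ∈ checkBox q (sysCheck q τ M),
      f (ν + hiddenShift n D p₁ Q b (fun k => k.valMinAbs) k) = f ν)
    (g : (Fin (n + 1) → ZN D p₁ Q) × Sd → ZQ Q → ℝ)
    (hg : ∀ o a', 0 ≤ g o a') (hg1 : ∀ o, ∑ a', g o a' = 1) :
    ((checkBox q (sysCheck q τ M)).card : ℝ)⁻¹
        * ∑ ν ∈ checkBox q (sysCheck q τ M), ∑ o, digitKernel n D p₁ Q b (chenOff n D w₀) f ν o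
          * g o (toDatum D p₁ Q ((chenOff n D w₀ ν 0 : ℤ) : ZN D p₁ Q))
      ≤ 1 / ((Q : ℕ) : ℝ) + ((D : ℕ) : ℝ) * ((p₁ : ℕ) : ℝ) * (((Q : ℕ) : ℝ) ^ 2 - 1)
          * (∑ i, ((b i).natAbs : ℝ)) / (2 * ((Q : ℕ) : ℝ) * q) :=
  chenSysCheckBoxDigitObserver_le_centred n D p₁ Q b hP hb hunit q τ hτ M
    (fun j => row_generates_of_block q τ M j e he (forall_gen_of_not_mem_badBlocks q hV j))
    hbκ w₀ f hf g hg hg1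

end Block

/-! ### E. The informative regime of the cap (REFEREE R-63.4) -/

section Regime

/-- **The cap is informative iff `Dp₁(Q+1)‖b‖₁ < 2q`** (`Q > 1`, `q > 0`): pure algebra on
`1/Q + Dp₁(Q²−1)B/(2Qq) < 1` (census §31.2). [folklore] -/
theorem cap_lt_one_iff {D p₁ Q B q : ℝ} (hQ : 1 < Q) (hq : 0 < q) :
    1 / Q + D * p₁ * (Q ^ 2 - 1) * B / (2 * Q * q) < 1 ↔ D * p₁ * (Q + 1) * B < 2 * q := by
  have hQ0 : 0 < Q := by linarith
  have h2 : 0 < 2 * Q * q := by positivity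
  rw [div_add_div _ _ hQ0.ne' h2.ne', div_lt_one (mul_pos hQ0 h2)]
  constructor
  · intro h
    by_contra hc
    have hprod : 0 ≤ Q * (Q - 1) * (D * p₁ * (Q + 1) * B - 2 * q) :=
      mul_nonneg (mul_pos hQ0 (sub_pos.2 hQ)).le (sub_nonneg.2 (not_lt.1 hc))
    nlinarith [hprod, h]
  · intro h
    have hprod : 0 < Q * (Q - 1) * (2 * q - D * p₁ * (Q + 1) * B) :=
      mul_pos (mul_pos hQ0 (sub_pos.2 hQ)) (sub_pos.2 h)
    nlinarith [hprod]

/-- With `N = p₁Q` (`Q ≥ 1`), `D·N·‖b‖₁ < q` implies the informative regime (census §31.2). [folklore] -/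
theorem cap_regime_of_DN {D p₁ Q N B q : ℝ} (hN : N = p₁ * Q) (hQ : 1 ≤ Q) (hD : 0 ≤ D)
    (hp : 0 ≤ p₁) (hB : 0 ≤ B) (h : D * N * B < q) : D * p₁ * (Q + 1) * B < 2 * q := by
  subst hN
  nlinarith [mul_nonneg (mul_nonneg hD hp) hB]

/-- `‖b‖₁ ≤ √(n+1)·‖b‖₂` on `ℤ^{n+1}` (Cauchy–Schwarz). [folklore] -/
theorem l1_le_sqrt_card_mul_l2 {n : ℕ} (b : Fin (n + 1) → ℤ) :
    (∑ i, ((b i).natAbs : ℝ)) ≤ Real.sqrt (n + 1 : ℝ) * Real.sqrt (∑ i, ((b i : ℤ) : ℝ) ^ 2) := by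
  have hcs := sum_mul_sq_le_sq_mul_sq (univ : Finset (Fin (n + 1))) (fun _ => (1 : ℝ))
    (fun i => ((b i).natAbs : ℝ))
  simp only [one_mul, one_pow, sum_const, card_univ, Fintype.card_fin, nsmul_eq_mul, mul_one] at hcs
  have habs : ∀ i, ((b i).natAbs : ℝ) ^ 2 = ((b i : ℤ) : ℝ) ^ 2 := fun i => by
    rw [Nat.cast_natAbs, Int.cast_abs, sq_abs]
  simp only [habs] at hcs
  have hnn : 0 ≤ ∑ i, ((b i).natAbs : ℝ) := sum_nonneg fun i _ => Nat.cast_nonneg _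
  calc (∑ i, ((b i).natAbs : ℝ)) = Real.sqrt ((∑ i, ((b i).natAbs : ℝ)) ^ 2) := (Real.sqrt_sq hnn).symm
    _ ≤ Real.sqrt ((n + 1 : ℝ) * ∑ i, ((b i : ℤ) : ℝ) ^ 2) := Real.sqrt_le_sqrt (by exact_mod_cast hcs)
    _ = Real.sqrt (n + 1 : ℝ) * Real.sqrt (∑ i, ((b i : ℤ) : ℝ) ^ 2) :=
        Real.sqrt_mul (by positivity) _

/-- **The regime from a modulus bound**: if `q ≥ K·D·N·‖b‖₂²` and `√(n+1) < K·‖b‖₂` (at Chen's sizes: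
`K = 31D²log⁵n` from C.4/C.7, `‖b‖₂ ≥ 0.8p₁√(ℓ(n−κ))` from Lemma 3.6 (3) — both by hand, census §31.2),
then `D·N·‖b‖₁ < q` (census §31.2). [folklore] -/
theorem cap_regime_of_norm_bound {D N K B₁ B₂ S q : ℝ} (hD : 0 < D) (hN : 0 < N) (hB₂ : 0 ≤ B₂)
    (hS : 0 ≤ S) (hB : B₁ ≤ S * B₂) (hK : S < K * B₂) (hq : K * D * N * B₂ ^ 2 ≤ q) :
    D * N * B₁ < q := by
  have hDN : 0 < D * N := mul_pos hD hN
  rcases eq_or_lt_of_le hB₂ with h0 | hB₂'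
  · -- `B₂ = 0` forces `S < 0`, contradiction
    rw [← h0, mul_zero] at hK
    exact absurd hK (not_lt.2 hS)
  · calc D * N * B₁ ≤ D * N * (S * B₂) := mul_le_mul_of_nonneg_left hB hDN.le
      _ < D * N * (K * B₂ * B₂) :=
          mul_lt_mul_of_pos_left (mul_lt_mul_of_pos_right hK hB₂') hDN
      _ = K * D * N * B₂ ^ 2 := by ring
      _ ≤ q := hq

end Regime

end Literature.Computability.Cryptography.Chen2024
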